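import Summits.AtomisticToContinuum.BoseEinsteinCondensation.Theorems.BECThomsonPrincipleGDTransferSeededWitnessDefs
import Summits.AtomisticToContinuum.BoseEinsteinCondensation.Theorems.BECThomsonPrincipleGDTransferBareAdmissible

/-!
# Route `BECThomsonPrinciple`, crux `GDTransfer` (stmt-AtomisticToContinuum-9482), line `seeded-continuity`:
# stub `stub_plainPairCost`, part 1 — the energy form as the diagonal of the sesquilinear forms `t + 𝓥`

Support file of the registered stub `stub_plainPairCost` (`PlainKineticIdentity → PlainInteractionBound →
PlainPairCost`).  The `ℝ≥0∞`-valued energy form `𝓔(f) = eform v L f = ∫⁻ (|∇f|² + V|f|²)` of the line's Defs file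
and the complex sesquilinear forms `t(f, g) = tform m L f g = ∫ Σ conj(∂f)∂g`, `𝓥(f, g) = vform v m L f g =
∫ V conj(f) g` of the second Defs file are bridged: for `C¹` data of finite energy form,
`𝓔(f).toReal = Re t(f, f) + Re 𝓥(f, f)` (`eform_toReal_eq`); `t` and `⟨·,·⟩` are conjugate-symmetric; the
`𝓥`-integrand `V conj(f) g` is integrable as soon as `∫ V|f|², ∫ V|g|² < ∞` (`integrable_vIntegrand`, by
`|fg| ≤ |f|² + |g|²`).  These are the bookkeeping identities behind the Kennedy–Lieb–Shastry second variation
of the plain pair (parts 2–4).  All [folklore].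
-/

noncomputable section

open MeasureTheory Filter
open scoped ENNReal NNReal ComplexConjugate

namespace Summit.AtomisticToContinuum.BoseEinsteinCondensation.Cruxes.GDTransfer.Seeded

namespace PlainCost

open Literature.MathematicalPhysics.QuantumManyBody.BoseGas
open Summit.AtomisticToContinuum.BoseEinsteinCondensation.Cruxes.GDTransfer.DysonDressedWitness

variable {m : ℕ} {L : ℝ} {v : ℝ → ℝ≥0∞}

/-! ## Measurability and continuity of the integrands -/

/-- The periodic interaction `V = Σ_{a<b} v^per(x_a − x_b)` is measurable. [folklore] -/
theorem measurable_periodicInteraction (hv : Measurable v) (L : ℝ) :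
    Measurable (periodicInteraction (N := m + 1) v L) := by
  unfold periodicInteraction
  refine Finset.measurable_sum _ fun a _ => Finset.measurable_sum _ fun b _ => ?_
  exact Bare.measurable_pairPot hv L a b

/-- `V·|f|²` is measurable for continuous `f`. [folklore] -/
theorem measurable_W_mul_sq (hv : Measurable v) (L : ℝ) {f : Config (m + 1) → ℂ} (hf : Continuous f) :
    Measurable fun X : Config (m + 1) => periodicInteraction v L X * ((‖f X‖₊ : ℝ≥0∞)) ^ 2 :=
  (measurable_periodicInteraction hv L).mul (Bare.measurable_nnnorm_sq hf.measurable)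

/-- The `t`-integrand `Σ_{j,a} conj(∂_{j,a}f) ∂_{j,a}g` is continuous for `C¹` data. [folklore] -/
theorem continuous_tIntegrand {f g : Config (m + 1) → ℂ} (hf : ContDiff ℝ 1 f) (hg : ContDiff ℝ 1 g) :
    Continuous fun X : Config (m + 1) => ∑ j : Fin (m + 1), ∑ a : Fin 3,
      conj (fderiv ℝ f X (Pi.single j (EuclideanSpace.single a (1 : ℝ)))) *
        fderiv ℝ g X (Pi.single j (EuclideanSpace.single a (1 : ℝ))) := by
  have hcf := hf.continuous_fderiv one_ne_zero
  have hcg := hg.continuous_fderiv one_ne_zero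
  refine continuous_finsetSum _ fun j _ => continuous_finsetSum _ fun a _ => ?_
  exact (Complex.continuous_conj.comp (hcf.clm_apply continuous_const)).mul
    (hcg.clm_apply continuous_const)

/-- The `t`-integrand is integrable on the cell for `C¹` data. [folklore] -/
theorem integrable_tIntegrand {f g : Config (m + 1) → ℂ} (hf : ContDiff ℝ 1 f) (hg : ContDiff ℝ 1 g) :
    Integrable (fun X : Config (m + 1) => ∑ j : Fin (m + 1), ∑ a : Fin 3,
      conj (fderiv ℝ f X (Pi.single j (EuclideanSpace.single a (1 : ℝ)))) *
        fderiv ℝ g X (Pi.single j (EuclideanSpace.single a (1 : ℝ))))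
      ((volume : Measure (Config (m + 1))).restrict (cellN (m + 1) L)) :=
  integrableOn_cellN (continuous_tIntegrand hf hg) L

/-- The inner-product integrand `conj(f) g` is integrable on the cell for continuous data. [folklore] -/
theorem integrable_inner {f g : Config (m + 1) → ℂ} (hf : Continuous f) (hg : Continuous g) :
    Integrable (fun X : Config (m + 1) => conj (f X) * g X)
      ((volume : Measure (Config (m + 1))).restrict (cellN (m + 1) L)) :=
  integrableOn_cellN ((Complex.continuous_conj.comp hf).mul hg) L

/-! ## Conjugate symmetry -/

/-- `t(f, g) = conj t(g, f)`. [folklore] -/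
theorem tform_conj_symm (f g : Config (m + 1) → ℂ) : tform m L f g = conj (tform m L g f) := by
  unfold tform
  rw [← integral_conj]
  refine integral_congr_ae (Eventually.of_forall fun X => ?_)
  simp only [map_sum, map_mul, Complex.conj_conj]
  refine Finset.sum_congr rfl fun j _ => Finset.sum_congr rfl fun a _ => ?_
  ring

/-- `⟨f, g⟩ = conj ⟨g, f⟩`. [folklore] -/
theorem inner_conj_symm (f g : Config (m + 1) → ℂ) :
    ∫ X in cellN (m + 1) L, conj (f X) * g X = conj (∫ X in cellN (m + 1) L, conj (g X) * f X) := by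
  rw [← integral_conj]
  refine integral_congr_ae (Eventually.of_forall fun X => ?_)
  simp only [map_mul, Complex.conj_conj]
  ring

/-- `Re t(g, f) = Re t(f, g)`. [folklore] -/
theorem tform_re_comm (f g : Config (m + 1) → ℂ) : (tform m L g f).re = (tform m L f g).re := by
  rw [tform_conj_symm g f, Complex.conj_re]

/-- `Re ⟨g, f⟩ = Re ⟨f, g⟩`. [folklore] -/
theorem inner_re_comm (f g : Config (m + 1) → ℂ) :
    (∫ X in cellN (m + 1) L, conj (g X) * f X).re = (∫ X in cellN (m + 1) L, conj (f X) * g X).re := by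
  rw [inner_conj_symm g f, Complex.conj_re]

/-! ## The diagonals -/

/-- `t(f, f) = ∫ |∇f|²` (the real kinetic energy, cast to `ℂ`). [folklore] -/
theorem tform_self (f : Config (m + 1) → ℂ) : tform m L f f = ((cellKineticEnergy L f : ℝ) : ℂ) := by
  unfold tform cellKineticEnergy kineticDensityReal
  rw [← integral_complex_ofReal]
  refine integral_congr_ae (Eventually.of_forall fun X => ?_)
  push_cast
  refine Finset.sum_congr rfl fun j _ => Finset.sum_congr rfl fun a _ => ?_
  rw [Complex.conj_mul']

/-- `∫⁻ |∇f|² = ofReal (Re t(f, f))` for `C¹` `f`. [folklore] -/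
theorem lintegral_kineticDensity_eq_ofReal {f : Config (m + 1) → ℂ} (hf : ContDiff ℝ 1 f) :
    ∫⁻ X in cellN (m + 1) L, kineticDensity f X = ENNReal.ofReal (tform m L f f).re := by
  rw [lintegral_kineticDensity_eq hf, tform_self, Complex.ofReal_re]

/-- `Re t(f, f) ≥ 0`. [folklore] -/
theorem tform_self_re_nonneg (f : Config (m + 1) → ℂ) : 0 ≤ (tform m L f f).re := by
  rw [tform_self, Complex.ofReal_re]
  exact cellKineticEnergy_nonneg L f

/-- `(V|z|²).toReal = V.toReal |z|²`. [folklore] -/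
theorem toReal_W_mul_sq (W : ℝ≥0∞) (z : ℂ) : (W * ((‖z‖₊ : ℝ≥0∞)) ^ 2).toReal = W.toReal * ‖z‖ ^ 2 := by
  rw [ENNReal.toReal_mul, coe_nnnorm_sq_eq_ofReal, ENNReal.toReal_ofReal (sq_nonneg _)]

/-- `𝓥(f, f) = ∫ V|f|²` (a real Bochner integral, cast to `ℂ`). [folklore] -/
theorem vform_self (f : Config (m + 1) → ℂ) :
    vform v m L f f = ((∫ X in cellN (m + 1) L, (periodicInteraction v L X).toReal * ‖f X‖ ^ 2 : ℝ) : ℂ) := by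
  unfold vform
  rw [← integral_complex_ofReal]
  refine integral_congr_ae (Eventually.of_forall fun X => ?_)
  beta_reduce
  rw [Complex.conj_mul', Complex.ofReal_mul, Complex.ofReal_pow]

/-- `Re 𝓥(f, f) ≥ 0`. [folklore] -/
theorem vform_self_re_nonneg (f : Config (m + 1) → ℂ) : 0 ≤ (vform v m L f f).re := by
  rw [vform_self, Complex.ofReal_re]
  exact integral_nonneg fun X => mul_nonneg ENNReal.toReal_nonneg (sq_nonneg _)

/-- `∫⁻ V|f|² ≤ 𝓔(f)`. [folklore] -/
theorem lintegral_W_le_eform (v : ℝ → ℝ≥0∞) (L : ℝ) (f : Config (m + 1) → ℂ) :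
    ∫⁻ X in cellN (m + 1) L, periodicInteraction v L X * ((‖f X‖₊ : ℝ≥0∞)) ^ 2 ≤ eform v L f := by
  rw [Bare.eform_eq_add]
  exact le_add_self

/-- `∫⁻ |∇f|² ≤ 𝓔(f)`. [folklore] -/
theorem lintegral_kineticDensity_le_eform (v : ℝ → ℝ≥0∞) (L : ℝ) (f : Config (m + 1) → ℂ) :
    ∫⁻ X in cellN (m + 1) L, kineticDensity f X ≤ eform v L f := by
  rw [Bare.eform_eq_add]
  exact le_self_add

/-- `V.toReal |f|²` is integrable on the cell when `∫⁻ V|f|² < ∞`. [folklore] -/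
theorem integrable_W_normSq (hv : Measurable v) {f : Config (m + 1) → ℂ} (hf : Continuous f)
    (hfin : ∫⁻ X in cellN (m + 1) L, periodicInteraction v L X * ((‖f X‖₊ : ℝ≥0∞)) ^ 2 ≠ ⊤) :
    Integrable (fun X : Config (m + 1) => (periodicInteraction v L X).toReal * ‖f X‖ ^ 2)
      ((volume : Measure (Config (m + 1))).restrict (cellN (m + 1) L)) := by
  have h := integrable_toReal_of_lintegral_ne_top (measurable_W_mul_sq hv L hf).aemeasurable hfin
  simpa only [toReal_W_mul_sq] using h

/-- `∫⁻ V|f|² = ofReal (Re 𝓥(f, f))` when the left side is finite. [folklore] -/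
theorem lintegral_W_eq_ofReal (hv : Measurable v) {f : Config (m + 1) → ℂ} (hf : Continuous f)
    (hfin : ∫⁻ X in cellN (m + 1) L, periodicInteraction v L X * ((‖f X‖₊ : ℝ≥0∞)) ^ 2 ≠ ⊤) :
    ∫⁻ X in cellN (m + 1) L, periodicInteraction v L X * ((‖f X‖₊ : ℝ≥0∞)) ^ 2 =
      ENNReal.ofReal (vform v m L f f).re := by
  have hmeas := (measurable_W_mul_sq hv L hf).aemeasurable
    (μ := (volume : Measure (Config (m + 1))).restrict (cellN (m + 1) L))
  rw [vform_self, Complex.ofReal_re]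
  have h2 : ∫ X in cellN (m + 1) L, (periodicInteraction v L X).toReal * ‖f X‖ ^ 2 =
      (∫⁻ X in cellN (m + 1) L, periodicInteraction v L X * ((‖f X‖₊ : ℝ≥0∞)) ^ 2).toReal := by
    rw [← integral_toReal hmeas (ae_lt_top' hmeas hfin)]
    simp only [toReal_W_mul_sq]
  rw [h2, ENNReal.ofReal_toReal hfin]

/-- **The bridge**: `𝓔(f).toReal = Re t(f, f) + Re 𝓥(f, f)` for `C¹` `f` of finite energy form. [folklore] -/
theorem eform_toReal_eq (hv : Measurable v) {f : Config (m + 1) → ℂ} (hf : ContDiff ℝ 1 f)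
    (hfin : eform v L f ≠ ⊤) :
    (eform v L f).toReal = (tform m L f f).re + (vform v m L f f).re := by
  have hW := ne_top_of_le_ne_top hfin (lintegral_W_le_eform v L f)
  rw [Bare.eform_eq_add, lintegral_kineticDensity_eq_ofReal hf, lintegral_W_eq_ofReal hv hf.continuous hW,
    ENNReal.toReal_add ENNReal.ofReal_ne_top ENNReal.ofReal_ne_top,
    ENNReal.toReal_ofReal (tform_self_re_nonneg f), ENNReal.toReal_ofReal (vform_self_re_nonneg f)]

/-- The mass is the diagonal of the inner product: `‖f‖².toReal = Re ⟨f, f⟩` for continuous `f`. [folklore] -/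
theorem mass_toReal_eq (L : ℝ) {f : Config (m + 1) → ℂ} (hf : Continuous f) :
    (mass L f).toReal = (∫ X in cellN (m + 1) L, conj (f X) * f X).re := by
  unfold mass
  rw [Lnss.lintegral_nnnorm_sq_eq _ hf, Lnss.integral_conj_mul_self, Complex.ofReal_re,
    ENNReal.toReal_ofReal (integral_nonneg fun X => sq_nonneg _)]

/-! ## The `𝓥`-integrand is integrable under finite `∫ V|f|²`, `∫ V|g|²` -/

/-- **`V conj(f) g` is integrable on the cell** if `∫⁻ V|f|², ∫⁻ V|g|² < ∞` (`|fg| ≤ |f|² + |g|²`). [folklore] -/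
theorem integrable_vIntegrand (hv : Measurable v) {f g : Config (m + 1) → ℂ} (hf : Continuous f)
    (hg : Continuous g)
    (hff : ∫⁻ X in cellN (m + 1) L, periodicInteraction v L X * ((‖f X‖₊ : ℝ≥0∞)) ^ 2 ≠ ⊤)
    (hgg : ∫⁻ X in cellN (m + 1) L, periodicInteraction v L X * ((‖g X‖₊ : ℝ≥0∞)) ^ 2 ≠ ⊤) :
    Integrable (fun X : Config (m + 1) => ((periodicInteraction v L X).toReal : ℂ) * (conj (f X) * g X))
      ((volume : Measure (Config (m + 1))).restrict (cellN (m + 1) L)) := by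
  have hF := integrable_W_normSq hv hf hff
  have hG := integrable_W_normSq hv hg hgg
  refine Integrable.mono' (hF.add hG) ?_ (Eventually.of_forall fun X => ?_)
  · exact ((Complex.measurable_ofReal.comp (measurable_periodicInteraction hv L).ennreal_toReal).mul
      ((Complex.continuous_conj.measurable.comp hf.measurable).mul hg.measurable)).aestronglyMeasurable
  · rw [norm_mul, norm_mul, Complex.norm_real, Real.norm_of_nonneg ENNReal.toReal_nonneg,
      Complex.norm_conj, Pi.add_apply]
    have h0 : 0 ≤ (periodicInteraction v L X).toReal := ENNReal.toReal_nonneg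
    have h1 : ‖f X‖ * ‖g X‖ ≤ ‖f X‖ ^ 2 + ‖g X‖ ^ 2 := by
      nlinarith [sq_nonneg (‖f X‖ - ‖g X‖), norm_nonneg (f X), norm_nonneg (g X)]
    calc (periodicInteraction v L X).toReal * (‖f X‖ * ‖g X‖)
        ≤ (periodicInteraction v L X).toReal * (‖f X‖ ^ 2 + ‖g X‖ ^ 2) :=
          mul_le_mul_of_nonneg_left h1 h0
      _ = _ := by ring


/-! ## Expansion of the forms along a real line `g + τ f` -/

/-- Linearity of the Bochner integral along a line: `∫ (F + cG + cH + c²K) = ∫F + c∫G + c∫H + c²∫K`. [folklore] -/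
theorem integral_lineQuad {μ : Measure (Config (m + 1))} {F G H K : Config (m + 1) → ℂ}
    (hF : Integrable F μ) (hG : Integrable G μ) (hH : Integrable H μ) (hK : Integrable K μ) (c : ℂ) :
    ∫ X, (F X + c * G X + c * H X + c ^ 2 * K X) ∂μ =
      (∫ X, F X ∂μ) + c * (∫ X, G X ∂μ) + c * (∫ X, H X ∂μ) + c ^ 2 * (∫ X, K X ∂μ) := by
  have h2 : Integrable (fun X => F X + c * G X) μ := hF.add (hG.const_mul c)
  have h3 : Integrable (fun X => F X + c * G X + c * H X) μ := h2.add (hH.const_mul c)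
  rw [integral_add h3 (hK.const_mul _), integral_add h2 (hH.const_mul _), integral_add hF (hG.const_mul _),
    integral_const_mul, integral_const_mul, integral_const_mul]

/-- `∂(g + τf) = ∂g + τ ∂f`, applied to a vector. [folklore] -/
theorem fderiv_line_apply {f g : Config (m + 1) → ℂ} (hf : Differentiable ℝ f) (hg : Differentiable ℝ g)
    (τ : ℝ) (X V : Config (m + 1)) :
    fderiv ℝ (fun Y => g Y + (τ : ℂ) * f Y) X V = fderiv ℝ g X V + (τ : ℂ) * fderiv ℝ f X V := by
  rw [fderiv_fun_add (hg X) ((hf X).const_mul _)]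
  have h : fderiv ℝ (fun Y => (τ : ℂ) * f Y) X = (τ : ℂ) • fderiv ℝ f X := fderiv_fun_const_smul (hf X) (τ : ℂ)
  rw [h]
  rfl

/-- **`t` along a line**: `Re t(g+τf, g+τf) = Re t(g,g) + 2τ Re t(f,g) + τ² Re t(f,f)`. [folklore] -/
theorem tform_line_re {f g : Config (m + 1) → ℂ} (hf : ContDiff ℝ 1 f) (hg : ContDiff ℝ 1 g) (τ : ℝ) :
    (tform m L (fun X => g X + (τ : ℂ) * f X) (fun X => g X + (τ : ℂ) * f X)).re =
      (tform m L g g).re + 2 * τ * (tform m L f g).re + τ ^ 2 * (tform m L f f).re := by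
  have hfd : Differentiable ℝ f := hf.differentiable one_ne_zero
  have hgd : Differentiable ℝ g := hg.differentiable one_ne_zero
  have igg := integrable_tIntegrand (L := L) hg hg
  have igf := integrable_tIntegrand (L := L) hg hf
  have ifg := integrable_tIntegrand (L := L) hf hg
  have iff := integrable_tIntegrand (L := L) hf hf
  have key : tform m L (fun X => g X + (τ : ℂ) * f X) (fun X => g X + (τ : ℂ) * f X) =
      tform m L g g + (τ : ℂ) * tform m L g f + (τ : ℂ) * tform m L f g + (τ : ℂ) ^ 2 * tform m L f f := by
    unfold tform
    rw [← integral_lineQuad igg igf ifg iff (τ : ℂ)]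
    refine integral_congr_ae (Eventually.of_forall fun X => ?_)
    simp only [fderiv_line_apply hfd hgd τ X, map_add, map_mul, Complex.conj_ofReal, Finset.mul_sum,
      ← Finset.sum_add_distrib]
    refine Finset.sum_congr rfl fun j _ => Finset.sum_congr rfl fun a _ => ?_
    ring
  rw [key, ← Complex.ofReal_pow]
  simp only [Complex.add_re, Complex.re_ofReal_mul, tform_re_comm f g]
  ring

/-- `𝓥(f, g) = conj 𝓥(g, f)`. [folklore] -/
theorem vform_conj_symm (f g : Config (m + 1) → ℂ) : vform v m L f g = conj (vform v m L g f) := by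
  unfold vform
  rw [← integral_conj]
  refine integral_congr_ae (Eventually.of_forall fun X => ?_)
  simp only [map_mul, Complex.conj_conj, Complex.conj_ofReal]
  ring

/-- `Re 𝓥(g, f) = Re 𝓥(f, g)`. [folklore] -/
theorem vform_re_comm (f g : Config (m + 1) → ℂ) : (vform v m L g f).re = (vform v m L f g).re := by
  rw [vform_conj_symm g f, Complex.conj_re]

/-- **`𝓥` along a line**: `Re 𝓥(g+τf, g+τf) = Re 𝓥(g,g) + 2τ Re 𝓥(f,g) + τ² Re 𝓥(f,f)` when
`∫⁻ V|f|², ∫⁻ V|g|² < ∞`. [folklore] -/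
theorem vform_line_re (hv : Measurable v) {f g : Config (m + 1) → ℂ} (hf : Continuous f) (hg : Continuous g)
    (hff : ∫⁻ X in cellN (m + 1) L, periodicInteraction v L X * ((‖f X‖₊ : ℝ≥0∞)) ^ 2 ≠ ⊤)
    (hgg : ∫⁻ X in cellN (m + 1) L, periodicInteraction v L X * ((‖g X‖₊ : ℝ≥0∞)) ^ 2 ≠ ⊤) (τ : ℝ) :
    (vform v m L (fun X => g X + (τ : ℂ) * f X) (fun X => g X + (τ : ℂ) * f X)).re =
      (vform v m L g g).re + 2 * τ * (vform v m L f g).re + τ ^ 2 * (vform v m L f f).re := by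
  have igg := integrable_vIntegrand hv hg hg hgg hgg
  have igf := integrable_vIntegrand hv hg hf hgg hff
  have ifg := integrable_vIntegrand hv hf hg hff hgg
  have iff := integrable_vIntegrand hv hf hf hff hff
  have key : vform v m L (fun X => g X + (τ : ℂ) * f X) (fun X => g X + (τ : ℂ) * f X) =
      vform v m L g g + (τ : ℂ) * vform v m L g f + (τ : ℂ) * vform v m L f g + (τ : ℂ) ^ 2 * vform v m L f f := by
    unfold vform
    rw [← integral_lineQuad igg igf ifg iff (τ : ℂ)]
    refine integral_congr_ae (Eventually.of_forall fun X => ?_)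
    simp only [map_add, map_mul, Complex.conj_ofReal]
    ring
  rw [key, ← Complex.ofReal_pow]
  simp only [Complex.add_re, Complex.re_ofReal_mul, vform_re_comm f g]
  ring

/-- **The mass along a line**: `‖g+τf‖².toReal = ‖g‖².toReal + 2τ Re⟨f, g⟩ + τ²‖f‖².toReal`. [folklore] -/
theorem mass_line_toReal {f g : Config (m + 1) → ℂ} (hf : Continuous f) (hg : Continuous g) (τ : ℝ) :
    (mass L (fun X => g X + (τ : ℂ) * f X)).toReal =
      (mass L g).toReal + 2 * τ * (∫ X in cellN (m + 1) L, conj (f X) * g X).re + τ ^ 2 * (mass L f).toReal := by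
  have igg := integrable_inner (L := L) hg hg
  have igf := integrable_inner (L := L) hg hf
  have ifg := integrable_inner (L := L) hf hg
  have iff := integrable_inner (L := L) hf hf
  rw [mass_toReal_eq L (f := fun X => g X + (τ : ℂ) * f X) (hg.add (continuous_const.mul hf)),
    mass_toReal_eq L hg, mass_toReal_eq L hf]
  have key : (∫ X in cellN (m + 1) L, conj (g X + (τ : ℂ) * f X) * (g X + (τ : ℂ) * f X)) =
      (∫ X in cellN (m + 1) L, conj (g X) * g X) + (τ : ℂ) * (∫ X in cellN (m + 1) L, conj (g X) * f X) +
        (τ : ℂ) * (∫ X in cellN (m + 1) L, conj (f X) * g X) +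
          (τ : ℂ) ^ 2 * (∫ X in cellN (m + 1) L, conj (f X) * f X) := by
    rw [← integral_lineQuad igg igf ifg iff (τ : ℂ)]
    refine integral_congr_ae (Eventually.of_forall fun X => ?_)
    simp only [map_add, map_mul, Complex.conj_ofReal]
    ring
  rw [key, ← Complex.ofReal_pow]
  simp only [Complex.add_re, Complex.re_ofReal_mul, inner_re_comm f g]
  ring

/-- The energy form stays finite along a line. [folklore] -/
theorem eform_line_ne_top (hv : Measurable v) {f g : Config (m + 1) → ℂ} (hf : ContDiff ℝ 1 f)
    (hg : ContDiff ℝ 1 g) (hfe : eform v L f ≠ ⊤) (hge : eform v L g ≠ ⊤) (c : ℂ) :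
    eform v L (fun X => g X + c * f X) ≠ ⊤ := by
  have h := Bare.eform_add_le (L := L) (a := g) (b := fun X => c * f X) hv hg (contDiff_const.mul hf)
  rw [ChordVariation.eform_smul v c hf] at h
  exact ne_top_of_le_ne_top (ENNReal.add_ne_top.2 ⟨ENNReal.mul_ne_top ENNReal.ofNat_ne_top hge,
    ENNReal.mul_ne_top ENNReal.ofNat_ne_top (ENNReal.mul_ne_top (ENNReal.pow_ne_top ENNReal.coe_ne_top) hfe)⟩) h

/-- **The energy form along a line**:
`𝓔(g+τf).toReal = 𝓔(g).toReal + 2τ (Re t(f,g) + Re 𝓥(f,g)) + τ² 𝓔(f).toReal`. [folklore] -/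
theorem eform_line_toReal (hv : Measurable v) {f g : Config (m + 1) → ℂ} (hf : ContDiff ℝ 1 f)
    (hg : ContDiff ℝ 1 g) (hfe : eform v L f ≠ ⊤) (hge : eform v L g ≠ ⊤) (τ : ℝ) :
    (eform v L (fun X => g X + (τ : ℂ) * f X)).toReal =
      (eform v L g).toReal + 2 * τ * ((tform m L f g).re + (vform v m L f g).re) +
        τ ^ 2 * (eform v L f).toReal := by
  have hhe := eform_line_ne_top hv hf hg hfe hge (τ : ℂ)
  have hWf := ne_top_of_le_ne_top hfe (lintegral_W_le_eform v L f)
  have hWg := ne_top_of_le_ne_top hge (lintegral_W_le_eform v L g)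
  rw [eform_toReal_eq hv (f := fun X => g X + (τ : ℂ) * f X) (hg.add (contDiff_const.mul hf)) hhe,
    eform_toReal_eq hv hg hge, eform_toReal_eq hv hf hfe, tform_line_re hf hg τ,
    vform_line_re hv hf.continuous hg.continuous hWf hWg τ]
  ring

/-! ## Cauchy–Schwarz for the excess form `q̃ = 𝓔 − E₀‖·‖²` -/

/-- **Cauchy–Schwarz for the excess form**: with `q̃(f) = 𝓔(f) − E₀‖f‖²` (non-negative on directions) and
its polar form `q̃(f, g) = Re t(f,g) + Re 𝓥(f,g) − E₀ Re⟨f,g⟩`, `q̃(f, g)² ≤ q̃(f) q̃(g)` for directions of finite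
energy form (line trick: `0 ≤ q̃(g + τf)` for all real `τ`, and the discriminant). [folklore] -/
theorem cross_sq_le (hv : Measurable v) {f g : Config (m + 1) → ℂ} (hf : IsDirection m L f)
    (hg : IsDirection m L g) (hfe : eform v L f ≠ ⊤) (hge : eform v L g ≠ ⊤) :
    ((tform m L f g).re + (vform v m L f g).re -
        (periodicGroundStateEnergy v (m + 1) L).toReal *
          (∫ X in cellN (m + 1) L, conj (f X) * g X).re) ^ 2 ≤
      ((eform v L f).toReal - (periodicGroundStateEnergy v (m + 1) L).toReal * (mass L f).toReal) *
        ((eform v L g).toReal - (periodicGroundStateEnergy v (m + 1) L).toReal * (mass L g).toReal) := by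
  set e₀ := (periodicGroundStateEnergy v (m + 1) L).toReal with he₀
  set A := (eform v L f).toReal - e₀ * (mass L f).toReal with hA
  set C := (eform v L g).toReal - e₀ * (mass L g).toReal with hC
  set B := (tform m L f g).re + (vform v m L f g).re -
    e₀ * (∫ X in cellN (m + 1) L, conj (f X) * g X).re with hB
  have hq : ∀ τ : ℝ, 0 ≤ A * (τ * τ) + 2 * B * τ + C := by
    intro τ
    have hdir : IsDirection m L (fun X => g X + (τ : ℂ) * f X) :=
      ChordVariation.dir_add hg (ChordVariation.dir_const_mul hf _)
    have hfin := eform_line_ne_top hv hf.contDiff hg.contDiff hfe hge (τ : ℂ)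
    have h0 := ChordVariation.e0_mul_mass_le_eform_toReal v hdir hfin
    rw [eform_line_toReal hv hf.contDiff hg.contDiff hfe hge τ,
      mass_line_toReal hf.contDiff.continuous hg.contDiff.continuous τ] at h0
    rw [hA, hB, hC]
    nlinarith [h0]
  have hd := discrim_le_zero hq
  rw [discrim] at hd
  nlinarith [hd]

end PlainCost

/-- **Part 1 of `stub_plainPairCost` (registered helper statement)**: the energy form is the diagonal of the
sesquilinear forms, `𝓔(f).toReal = Re t(f, f) + Re 𝓥(f, f)` for `C¹` `f` of finite energy form and measurable
`v`. [folklore] -/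
theorem plainPairCost_eform_toReal_eq :
    ∀ (m : ℕ) (L : ℝ) (v : ℝ → ENNReal), Measurable v →
      ∀ f : Literature.MathematicalPhysics.QuantumManyBody.BoseGas.Config (m + 1) → ℂ, ContDiff ℝ 1 f →
        Summit.AtomisticToContinuum.BoseEinsteinCondensation.Cruxes.GDTransfer.DysonDressedWitness.eform v L f ≠ ⊤ →
          (Summit.AtomisticToContinuum.BoseEinsteinCondensation.Cruxes.GDTransfer.DysonDressedWitness.eform v L f).toReal =
            (tform m L f f).re + (vform v m L f f).re :=
  fun _ _ _ hv _ hf hfin => PlainCost.eform_toReal_eq hv hf hfin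

end Summit.AtomisticToContinuum.BoseEinsteinCondensation.Cruxes.GDTransfer.Seeded

end
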